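import Summits.CriticalPhenomena.PercolationContinuityZ3.Theorems.FK.DomainMarkovForcedWiringSum
import Summits.CriticalPhenomena.PercolationContinuityZ3.Theorems.FK.InfiniteVolumeGibbs
import Summits.CriticalPhenomena.PercolationContinuityZ3.Theorems.FK.InfiniteVolumeMeasures
import HarnessLib

/-!
# FK-continuity transplant, FO-10 (domain-Markov toolkit, seat A): the domain Markov property with the wiring
# FORCED BY THE HISTORY, for the infinite-volume random-cluster measures `φ^b_{p,q}` (box limits)

Cell `fk-continuity` (bschramm), row FO-10a; support file for the FK-continuity transplant
(`--supports stmt-CriticalPhenomena-4575`); builds on p205010 (kernel theorem, internal audit signed; external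
expert review pending).  Pure proofs; no definitions, no named facts, no sorries.  Third file of the chain
`DomainMarkovForcedWiring.lean` (per-cylinder domination) → `DomainMarkovForcedWiringSum.lean` (summed form,
edge-set regions, transport) → this file (the box laws, then `Λ_n ↑ ℤ^d`).

## The statement (Grimmett 2006, Lemma (4.13) with Lemma (4.14)(b), read under `φ^b_{p,q}`)

Data: a finite vertex piece `Λ ⊆ ℤ^d`; the FRESH lattice edges `F ⊆ E_Λ` with their copy `R` as edges of
`(Λ, E_Λ)` (`hFR`); a SEED `W ⊆ Λ`; an increasing event `A` determined by `F`; a HISTORY `H` determined by a finite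
pair set `T` disjoint from `F`, such that every `ω ∈ H` joins all vertices of `W` by `ω`-open paths (`H ⊆ {x ↔ y}`
for `x, y ∈ W` — e.g. `H` says that a cube containing `W` is open; as `H` is determined by `T`, the joining paths
live on `T`, off the fresh edges).  Conclusion, for every box limit `P` (`IsBoxLimit d b p q P`, `p ∈ [0,1]`,
`q ≥ 1`, either boundary condition `b`):

  `φ^W_{⟨R⟩,p,q}(A) · P(H) ≤ P(A ∩ H)`   (`IsBoxLimit.fromEdgeSet_real_mul_le_of_openConn`),

where `φ^W_{⟨R⟩,p,q} = rcMeasure (fromEdgeSet ↑R) p q W` is the random-cluster measure of the fresh edges with the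
seed wired, read on `ℤ^d` through `liftEdges Λ`; and the decreasing dual `P(D ∩ H) ≤ φ^W_{⟨R⟩,p,q}(D) · P(H)`.  In
words: conditionally on a history exhibiting an open seed, the fresh region dominates its own measure WITH THE
SEED WIRED (and everything else free) — the form in which a Kozma–Nitzan seed enters the next exploration step
under `φ_{p,q}` (cell SCOPING.md §3.6 C1 `φ^{0, C(h) wired}_{F(h)}`; FO-06a INTERFACE.md: "sharper lower bounds
crediting wiring FORCED by the history = FO-10 theorems over `IsBoxLimit`").  The vertex-induced case `F = E_Λ`
(`IsBoxLimit.region_real_mul_le_of_openConn`, law `rcMeasure (finsetGraph (zdGraph d) Λ) p q W`) with `W = ∅` is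
FO-06a's lower sandwich `IsBoxLimit.regionFreeReal_mul_le`; the gain is exactly the wiring the history exhibits.

## Contents

* `rcMeasure_fromEdgeSet_real_mul_rcBoxMeasure_le_of_openConn` / `rcBoxMeasure_real_inter_le_fromEdgeSet_real_mul_of_openConn`
  — the inequalities for the box laws `φ^b_{Λ_n,p,q}`, `Λ ⊆ Λ_n` (events read through `liftEdges (box d n)`).
* `IsBoxLimit.tendsto_rcBoxMeasure_real_preimage_liftEdges` — passage `Λ_n ↑ ℤ^d` for local events (FO-06b's
  `IsBoxLimit.tendsto_real`).
* **`IsBoxLimit.fromEdgeSet_real_mul_le_of_openConn`**, `IsBoxLimit.real_inter_le_fromEdgeSet_real_mul_of_openConn`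
  — the infinite-volume statements for edge-set regions; `IsBoxLimit.region_real_mul_le_of_openConn`,
  `IsBoxLimit.real_inter_le_region_real_mul_of_openConn` — vertex-induced regions `E_Λ`
  (`rcMeasure_fromEdgeSet_edgeFinset_real`); `regionFreeReal_eq` / `regionWiredReal_eq` identify FO-06a's region
  laws as the cases `W = ∅` / `W = ∂Λ`.  For THE measure `rcLimit d b p q` compose with
  `isBoxLimit_rcLimit_of_exists` (Defs) / FO-06b's `isBoxLimit_rcLimit`.

## References

* G. Grimmett, *The Random-Cluster Model*, Springer 2006: §4.2 (4.11)–(4.13), Lemma (4.13) p. 70, Lemma (4.14)(b)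
  p. 71 (proof p. 72–73: "the greater the connections off `Λ`, the larger is the induced measure within `Λ`"),
  §4.3 Thm. (4.19)(a) (box limits). [Grimmett2006]
-/

noncomputable section

open MeasureTheory Set Filter
open scoped Topology ENNReal

namespace Summit.CriticalPhenomena.PercolationContinuityZ3.Theorems.FK

open Literature.Probability.Percolation Literature.Probability.LatticeModels

/-! ### The box-level sandwich crediting the wiring forced by the history -/

section Box

open Finset SimpleGraph

variable {d : ℕ}

/-- **Box-level lower sandwich with a forced wiring** (Grimmett 2006, Lemma (4.13) + (4.14)(b), in the box
`Λ_n ⊇ Λ` with boundary condition `b`): with the data of the module docstring,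
`φ^W_{⟨R⟩,p,q}(A) · φ^b_{Λ_n,p,q}(H) ≤ φ^b_{Λ_n,p,q}(A ∩ H)` (events of `ℤ^d` read through `liftEdges (box d n)`).
[cite: Grimmett2006, Lemma (4.13) and Lemma (4.14)(b)] -/
theorem rcMeasure_fromEdgeSet_real_mul_rcBoxMeasure_le_of_openConn {p q : ℝ} (hp : p ∈ Set.Icc (0 : ℝ) 1)
    (hq : 1 ≤ q) (b : Bool) {n : ℕ} {Λ : Finset (Site d)} (hΛ : Λ ⊆ box d n) {F : Finset (Sym2 (Site d))}
    {R : Finset (Sym2 ↥Λ)} (hF : (↑F : Set (Sym2 (Site d))) ⊆ ↑(edgesIn (zdGraph d) Λ))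
    (hFR : ∀ e : Sym2 ↥Λ, e ∈ R ↔ Sym2.map Subtype.val e ∈ F) (W : Set ↥Λ)
    {A H : Set (BondConfig (Site d))} (T : Finset (Sym2 (Site d))) (hA : IsUpperSet A) (hAF : DeterminedBy A ↑F)
    (hT : Disjoint (↑T : Set (Sym2 (Site d))) ↑F) (hH : DeterminedBy H ↑T)
    (hHW : ∀ ω ∈ H, ∀ x ∈ W, ∀ y ∈ W, ω ∈ openConn (x : Site d) (y : Site d)) :
    (rcMeasure (fromEdgeSet (↑R : Set (Sym2 ↥Λ))) p q W).real (liftEdges Λ ⁻¹' A) *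
        (rcBoxMeasure d b p q n).real (liftEdges (box d n) ⁻¹' H) ≤
      (rcBoxMeasure d b p q n).real (liftEdges (box d n) ⁻¹' (A ∩ H)) := by
  have hq0 : 0 < q := one_pos.trans_le hq
  have hRE : R ⊆ (finsetGraph (zdGraph d) Λ).edgeFinset := fun e he =>
    (mem_edgeFinset_finsetGraph_iff e).2 (mem_edgesIn_iff.1 (Finset.mem_coe.1 (hF ((hFR e).1 he)))).1
  set U : Finset (Sym2 ↥(box d n)) := R.map (edgeLift hΛ) with hU
  have hUE : U ⊆ (finsetGraph (zdGraph d) (box d n)).edgeFinset := map_edgeLift_subset_edgeFinset hΛ hRE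
  -- the pulled-back events: `A` read inside `U`, `H` read off `U`
  have hRA : ∀ e : Sym2 ↥(box d n), Sym2.map Subtype.val e ∈ (↑F : Set (Sym2 (Site d))) →
      e ∈ (↑U : Set (Sym2 ↥(box d n))) := fun e he =>
    Finset.mem_coe.2 (mem_map_edgeLift_of_map_val_mem hΛ hF hFR he)
  have hRH : ∀ e : Sym2 ↥(box d n), Sym2.map Subtype.val e ∈ (↑T : Set (Sym2 (Site d))) →
      e ∈ (↑U : Set (Sym2 ↥(box d n)))ᶜ := by
    intro e he heU
    obtain ⟨e', he', rfl⟩ := Finset.mem_map.1 (Finset.mem_coe.1 heU)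
    rw [map_val_edgeLift] at he
    exact Set.disjoint_left.1 hT he (Finset.mem_coe.2 ((hFR e').1 he'))
  have hAU : ∀ ω, ω ∈ liftEdges (box d n) ⁻¹' A ↔ ω ∩ ↑U ∈ liftEdges (box d n) ⁻¹' A :=
    mem_preimage_liftEdges_iff_inter hRA hAF
  have hS : ∀ ω, ω ∈ liftEdges (box d n) ⁻¹' H ↔
      ω ∩ (↑U : Set (Sym2 ↥(box d n)))ᶜ ∈ liftEdges (box d n) ⁻¹' H :=
    mem_preimage_liftEdges_iff_inter hRH hH
  have hA' : IsUpperSet (liftEdges (box d n) ⁻¹' A) := fun ω ω' hle hω =>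
    hA (show liftEdges (box d n) ω ≤ liftEdges (box d n) ω' from Set.image_mono hle) hω
  -- every pattern of the history joins the copy of `W` inside the box
  have hSW : ∀ ξ ∈ liftEdges (box d n) ⁻¹' H, ξ ⊆ (finsetGraph (zdGraph d) (box d n)).edgeSet →
      Disjoint ξ (↑U : Set (Sym2 ↥(box d n))) → ∀ x ∈ finsetInclEmb hΛ '' W, ∀ y ∈ finsetInclEmb hΛ '' W,
        (fromEdgeSet ξ ⊔ wired (boxBC d b n)).Reachable x y := by
    rintro ξ hξ - - _ ⟨x, hx, rfl⟩ _ ⟨y, hy, rfl⟩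
    have hconn := hHW (liftEdges (box d n) ξ) hξ x hx y hy
    exact (reachable_of_mem_openConn_liftEdges (x := finsetInclEmb hΛ x) (y := finsetInclEmb hΛ y) hconn).mono
      le_sup_left
  have hmain := rcMeasure_fromEdgeSet_real_mul_le_real_inter_of_reachable (finsetGraph (zdGraph d) (box d n)) hp
    hq (boxBC d b n) U hUE hA' hAU hS hSW
  rw [hU, rcMeasure_fromEdgeSet_map_edgeLift_real hp hq0 hΛ hRE W A, ← Set.preimage_inter] at hmain
  exact hmain

/-- **Box-level upper bound for decreasing events with a forced wiring**: with the same data and a decreasing `D`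
determined by `F`, `φ^b_{Λ_n,p,q}(D ∩ H) ≤ φ^W_{⟨R⟩,p,q}(D) · φ^b_{Λ_n,p,q}(H)`.
[cite: Grimmett2006, Lemma (4.13) and Lemma (4.14)(b)] -/
theorem rcBoxMeasure_real_inter_le_fromEdgeSet_real_mul_of_openConn {p q : ℝ} (hp : p ∈ Set.Icc (0 : ℝ) 1)
    (hq : 1 ≤ q) (b : Bool) {n : ℕ} {Λ : Finset (Site d)} (hΛ : Λ ⊆ box d n) {F : Finset (Sym2 (Site d))}
    {R : Finset (Sym2 ↥Λ)} (hF : (↑F : Set (Sym2 (Site d))) ⊆ ↑(edgesIn (zdGraph d) Λ))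
    (hFR : ∀ e : Sym2 ↥Λ, e ∈ R ↔ Sym2.map Subtype.val e ∈ F) (W : Set ↥Λ)
    {D H : Set (BondConfig (Site d))} (T : Finset (Sym2 (Site d))) (hD : IsLowerSet D) (hDF : DeterminedBy D ↑F)
    (hT : Disjoint (↑T : Set (Sym2 (Site d))) ↑F) (hH : DeterminedBy H ↑T)
    (hHW : ∀ ω ∈ H, ∀ x ∈ W, ∀ y ∈ W, ω ∈ openConn (x : Site d) (y : Site d)) :
    (rcBoxMeasure d b p q n).real (liftEdges (box d n) ⁻¹' (D ∩ H)) ≤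
      (rcMeasure (fromEdgeSet (↑R : Set (Sym2 ↥Λ))) p q W).real (liftEdges Λ ⁻¹' D) *
        (rcBoxMeasure d b p q n).real (liftEdges (box d n) ⁻¹' H) := by
  have hq0 : 0 < q := one_pos.trans_le hq
  have hRE : R ⊆ (finsetGraph (zdGraph d) Λ).edgeFinset := fun e he =>
    (mem_edgeFinset_finsetGraph_iff e).2 (mem_edgesIn_iff.1 (Finset.mem_coe.1 (hF ((hFR e).1 he)))).1
  set U : Finset (Sym2 ↥(box d n)) := R.map (edgeLift hΛ) with hU
  have hUE : U ⊆ (finsetGraph (zdGraph d) (box d n)).edgeFinset := map_edgeLift_subset_edgeFinset hΛ hRE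
  have hRD : ∀ e : Sym2 ↥(box d n), Sym2.map Subtype.val e ∈ (↑F : Set (Sym2 (Site d))) →
      e ∈ (↑U : Set (Sym2 ↥(box d n))) := fun e he =>
    Finset.mem_coe.2 (mem_map_edgeLift_of_map_val_mem hΛ hF hFR he)
  have hRH : ∀ e : Sym2 ↥(box d n), Sym2.map Subtype.val e ∈ (↑T : Set (Sym2 (Site d))) →
      e ∈ (↑U : Set (Sym2 ↥(box d n)))ᶜ := by
    intro e he heU
    obtain ⟨e', he', rfl⟩ := Finset.mem_map.1 (Finset.mem_coe.1 heU)
    rw [map_val_edgeLift] at he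
    exact Set.disjoint_left.1 hT he (Finset.mem_coe.2 ((hFR e').1 he'))
  have hDU : ∀ ω, ω ∈ liftEdges (box d n) ⁻¹' D ↔ ω ∩ ↑U ∈ liftEdges (box d n) ⁻¹' D :=
    mem_preimage_liftEdges_iff_inter hRD hDF
  have hS : ∀ ω, ω ∈ liftEdges (box d n) ⁻¹' H ↔
      ω ∩ (↑U : Set (Sym2 ↥(box d n)))ᶜ ∈ liftEdges (box d n) ⁻¹' H :=
    mem_preimage_liftEdges_iff_inter hRH hH
  have hD' : IsLowerSet (liftEdges (box d n) ⁻¹' D) := fun ω ω' hle hω =>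
    hD (show liftEdges (box d n) ω' ≤ liftEdges (box d n) ω from Set.image_mono hle) hω
  have hSW : ∀ ξ ∈ liftEdges (box d n) ⁻¹' H, ξ ⊆ (finsetGraph (zdGraph d) (box d n)).edgeSet →
      Disjoint ξ (↑U : Set (Sym2 ↥(box d n))) → ∀ x ∈ finsetInclEmb hΛ '' W, ∀ y ∈ finsetInclEmb hΛ '' W,
        (fromEdgeSet ξ ⊔ wired (boxBC d b n)).Reachable x y := by
    rintro ξ hξ - - _ ⟨x, hx, rfl⟩ _ ⟨y, hy, rfl⟩
    have hconn := hHW (liftEdges (box d n) ξ) hξ x hx y hy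
    exact (reachable_of_mem_openConn_liftEdges (x := finsetInclEmb hΛ x) (y := finsetInclEmb hΛ y) hconn).mono
      le_sup_left
  have hmain := rcMeasure_real_inter_le_fromEdgeSet_real_mul_of_isLowerSet_of_reachable
    (finsetGraph (zdGraph d) (box d n)) hp hq (boxBC d b n) U hUE hD' hDU hS hSW
  rw [hU, rcMeasure_fromEdgeSet_map_edgeLift_real hp hq0 hΛ hRE W D, ← Set.preimage_inter] at hmain
  exact hmain

end Box

/-! ### Infinite volume: the box limits `φ^b_{p,q}` -/

section Limit

open SimpleGraph

variable {d : ℕ} {b : Bool} {p q : ℝ} {P : Measure (BondConfig (Site d))}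

/-- Real-valued convergence of the box laws of a local event to a box limit, read on the box measures (FO-06b's
`IsBoxLimit.tendsto_real` through `rcBoxLaw_real_apply`). [cite: Grimmett2006, Thm. (4.19)(a)] -/
theorem IsBoxLimit.tendsto_rcBoxMeasure_real_preimage_liftEdges (hP : IsBoxLimit d b p q P)
    {X : Set (BondConfig (Site d))} {K : Finset (Sym2 (Site d))} (hX : DeterminedBy X ↑K) :
    Tendsto (fun n => (rcBoxMeasure d b p q n).real (liftEdges (box d n) ⁻¹' X)) atTop (𝓝 (P.real X)) := by
  simp only [← rcBoxLaw_real_apply b p q _ hX.measurableSet_of_finset]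
  exact hP.tendsto_real ⟨K, hX⟩

/-- **Domain Markov with history-forced wiring, infinite volume, edge-set region** (Grimmett 2006, Lemma (4.13) +
Lemma (4.14)(b) under the box limit `φ^b_{p,q}`, `q ≥ 1`): with the data of the module docstring,
`φ^W_{⟨R⟩,p,q}(A) · P(H) ≤ P(A ∩ H)`. [cite: Grimmett2006, Lemma (4.13) and Lemma (4.14)(b)] -/
theorem IsBoxLimit.fromEdgeSet_real_mul_le_of_openConn (hP : IsBoxLimit d b p q P) (hp : p ∈ Set.Icc (0 : ℝ) 1)
    (hq : 1 ≤ q) (Λ : Finset (Site d)) {F : Finset (Sym2 (Site d))} {R : Finset (Sym2 ↥Λ)}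
    (hF : (↑F : Set (Sym2 (Site d))) ⊆ ↑(edgesIn (zdGraph d) Λ))
    (hFR : ∀ e : Sym2 ↥Λ, e ∈ R ↔ Sym2.map Subtype.val e ∈ F) (W : Set ↥Λ) {A H : Set (BondConfig (Site d))}
    (T : Finset (Sym2 (Site d))) (hA : IsUpperSet A) (hAF : DeterminedBy A ↑F)
    (hT : Disjoint (↑T : Set (Sym2 (Site d))) ↑F) (hH : DeterminedBy H ↑T)
    (hHW : ∀ ω ∈ H, ∀ x ∈ W, ∀ y ∈ W, ω ∈ openConn (x : Site d) (y : Site d)) :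
    (rcMeasure (fromEdgeSet (↑R : Set (Sym2 ↥Λ))) p q W).real (liftEdges Λ ⁻¹' A) * P.real H ≤ P.real (A ∩ H) := by
  classical
  have hAH : DeterminedBy (A ∩ H) ↑(F ∪ T) :=
    (hAF.mono (by rw [Finset.coe_union]; exact Set.subset_union_left)).inter
      (hH.mono (by rw [Finset.coe_union]; exact Set.subset_union_right))
  have hlimH := hP.tendsto_rcBoxMeasure_real_preimage_liftEdges hH
  have hlimAH := hP.tendsto_rcBoxMeasure_real_preimage_liftEdges hAH
  refine le_of_tendsto_of_tendsto (hlimH.const_mul _) hlimAH ?_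
  have hev : ∀ᶠ n in atTop, Λ ⊆ box d n := Filter.eventually_atTop.2 ⟨Λ.sup siteRad, fun _ hn _ hx =>
    mem_box_iff_siteRad_le.2 ((Finset.le_sup hx).trans hn)⟩
  filter_upwards [hev] with n hn
  exact rcMeasure_fromEdgeSet_real_mul_rcBoxMeasure_le_of_openConn hp hq b hn hF hFR W T hA hAF hT hH hHW

/-- **Decreasing events under a history-forced wiring, infinite volume, edge-set region**: with the same data and a
decreasing `D` determined by `F`, `P(D ∩ H) ≤ φ^W_{⟨R⟩,p,q}(D) · P(H)` — e.g. "the seed's cluster does not reach the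
next target through fresh edges" is, given a history wiring the seed, at most as likely as under the fresh region's
measure with the seed wired. [cite: Grimmett2006, Lemma (4.13) and Lemma (4.14)(b)] -/
theorem IsBoxLimit.real_inter_le_fromEdgeSet_real_mul_of_openConn (hP : IsBoxLimit d b p q P)
    (hp : p ∈ Set.Icc (0 : ℝ) 1) (hq : 1 ≤ q) (Λ : Finset (Site d)) {F : Finset (Sym2 (Site d))}
    {R : Finset (Sym2 ↥Λ)} (hF : (↑F : Set (Sym2 (Site d))) ⊆ ↑(edgesIn (zdGraph d) Λ))
    (hFR : ∀ e : Sym2 ↥Λ, e ∈ R ↔ Sym2.map Subtype.val e ∈ F) (W : Set ↥Λ) {D H : Set (BondConfig (Site d))}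
    (T : Finset (Sym2 (Site d))) (hD : IsLowerSet D) (hDF : DeterminedBy D ↑F)
    (hT : Disjoint (↑T : Set (Sym2 (Site d))) ↑F) (hH : DeterminedBy H ↑T)
    (hHW : ∀ ω ∈ H, ∀ x ∈ W, ∀ y ∈ W, ω ∈ openConn (x : Site d) (y : Site d)) :
    P.real (D ∩ H) ≤ (rcMeasure (fromEdgeSet (↑R : Set (Sym2 ↥Λ))) p q W).real (liftEdges Λ ⁻¹' D) * P.real H := by
  classical
  have hDH : DeterminedBy (D ∩ H) ↑(F ∪ T) :=
    (hDF.mono (by rw [Finset.coe_union]; exact Set.subset_union_left)).inter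
      (hH.mono (by rw [Finset.coe_union]; exact Set.subset_union_right))
  have hlimH := hP.tendsto_rcBoxMeasure_real_preimage_liftEdges hH
  have hlimDH := hP.tendsto_rcBoxMeasure_real_preimage_liftEdges hDH
  refine le_of_tendsto_of_tendsto hlimDH (hlimH.const_mul _) ?_
  have hev : ∀ᶠ n in atTop, Λ ⊆ box d n := Filter.eventually_atTop.2 ⟨Λ.sup siteRad, fun _ hn _ hx =>
    mem_box_iff_siteRad_le.2 ((Finset.le_sup hx).trans hn)⟩
  filter_upwards [hev] with n hn
  exact rcBoxMeasure_real_inter_le_fromEdgeSet_real_mul_of_openConn hp hq b hn hF hFR W T hD hDF hT hH hHW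

/-! ### Vertex-induced regions `F = E_Λ`: the laws `φ^W_{Λ,p,q}` of FO-06a's interface with a seed wired -/

/-- All edges of `(Λ, E_Λ)` correspond to `E_Λ`. [cite: Grimmett2006, §4.2 (E_Λ)] -/
theorem mem_edgeFinset_finsetGraph_iff_mem_edgesIn {Λ : Finset (Site d)} (e : Sym2 ↥Λ) :
    e ∈ (finsetGraph (zdGraph d) Λ).edgeFinset ↔ Sym2.map Subtype.val e ∈ edgesIn (zdGraph d) Λ := by
  rw [mem_edgeFinset_finsetGraph_iff, mem_edgesIn_iff]
  constructor
  · intro he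
    refine ⟨he, fun x hx => ?_⟩
    obtain ⟨y, -, rfl⟩ := Sym2.mem_map.1 hx
    exact y.2
  · exact fun h => h.1

/-- The free region law `φ⁰_{Λ,p,q}` of FO-06a is the case `W = ∅` of `φ^W_{Λ,p,q}`. [cite: Grimmett2006, §4.2 (4.11)–(4.12)] -/
theorem regionFreeReal_eq (p q : ℝ) (Λ : Finset (Site d)) (A : Set (BondConfig (Site d))) :
    regionFreeReal d p q Λ A = (rcMeasure (finsetGraph (zdGraph d) Λ) p q ∅).real (liftEdges Λ ⁻¹' A) := rfl

/-- The wired region law `φ¹_{Λ,p,q}` of FO-06a is the case `W = ∂Λ` of `φ^W_{Λ,p,q}`. [cite: Grimmett2006, §4.2 (4.11)–(4.12)] -/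
theorem regionWiredReal_eq (p q : ℝ) (Λ : Finset (Site d)) (A : Set (BondConfig (Site d))) :
    regionWiredReal d p q Λ A =
      (rcMeasure (finsetGraph (zdGraph d) Λ) p q (wiredBoundary (zdGraph d) Λ)).real (liftEdges Λ ⁻¹' A) := rfl

/-- **Domain Markov with history-forced wiring, infinite volume, vertex-induced region**: for a box limit `P`, a
finite region `Λ`, a seed `W ⊆ Λ`, an increasing `A` determined by `E_Λ`, and a history `H` determined by a finite
pair set `T` disjoint from `E_Λ` with `H ⊆ {x ↔ y}` for all `x, y ∈ W`:
`φ^W_{Λ,p,q}(A) · P(H) ≤ P(A ∩ H)`, `φ^W_{Λ,p,q} = rcMeasure (finsetGraph (zdGraph d) Λ) p q W`.  With `W = ∅`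
(`regionFreeReal_eq`) this is FO-06a's `IsBoxLimit.regionFreeReal_mul_le`. [cite: Grimmett2006, Lemma (4.13) and Lemma (4.14)(b)] -/
theorem IsBoxLimit.region_real_mul_le_of_openConn (hP : IsBoxLimit d b p q P) (hp : p ∈ Set.Icc (0 : ℝ) 1)
    (hq : 1 ≤ q) (Λ : Finset (Site d)) (W : Set ↥Λ) {A H : Set (BondConfig (Site d))}
    (T : Finset (Sym2 (Site d))) (hA : IsUpperSet A) (hAΛ : DeterminedBy A ↑(edgesIn (zdGraph d) Λ))
    (hT : Disjoint (↑T : Set (Sym2 (Site d))) ↑(edgesIn (zdGraph d) Λ)) (hH : DeterminedBy H ↑T)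
    (hHW : ∀ ω ∈ H, ∀ x ∈ W, ∀ y ∈ W, ω ∈ openConn (x : Site d) (y : Site d)) :
    (rcMeasure (finsetGraph (zdGraph d) Λ) p q W).real (liftEdges Λ ⁻¹' A) * P.real H ≤ P.real (A ∩ H) := by
  rw [← rcMeasure_fromEdgeSet_edgeFinset_real _ hp (one_pos.trans_le hq) W]
  exact hP.fromEdgeSet_real_mul_le_of_openConn hp hq Λ subset_rfl mem_edgeFinset_finsetGraph_iff_mem_edgesIn W T
    hA hAΛ hT hH hHW

/-- **Decreasing events, vertex-induced region**: `P(D ∩ H) ≤ φ^W_{Λ,p,q}(D) · P(H)` under the same hypotheses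
with `D` decreasing determined by `E_Λ`. [cite: Grimmett2006, Lemma (4.13) and Lemma (4.14)(b)] -/
theorem IsBoxLimit.real_inter_le_region_real_mul_of_openConn (hP : IsBoxLimit d b p q P)
    (hp : p ∈ Set.Icc (0 : ℝ) 1) (hq : 1 ≤ q) (Λ : Finset (Site d)) (W : Set ↥Λ)
    {D H : Set (BondConfig (Site d))} (T : Finset (Sym2 (Site d))) (hD : IsLowerSet D)
    (hDΛ : DeterminedBy D ↑(edgesIn (zdGraph d) Λ))
    (hT : Disjoint (↑T : Set (Sym2 (Site d))) ↑(edgesIn (zdGraph d) Λ)) (hH : DeterminedBy H ↑T)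
    (hHW : ∀ ω ∈ H, ∀ x ∈ W, ∀ y ∈ W, ω ∈ openConn (x : Site d) (y : Site d)) :
    P.real (D ∩ H) ≤ (rcMeasure (finsetGraph (zdGraph d) Λ) p q W).real (liftEdges Λ ⁻¹' D) * P.real H := by
  rw [← rcMeasure_fromEdgeSet_edgeFinset_real _ hp (one_pos.trans_le hq) W]
  exact hP.real_inter_le_fromEdgeSet_real_mul_of_openConn hp hq Λ subset_rfl
    mem_edgeFinset_finsetGraph_iff_mem_edgesIn W T hD hDΛ hT hH hHW

end Limit

end Summit.CriticalPhenomena.PercolationContinuityZ3.Theorems.FK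

end
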